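import Literature.AlgebraicGeometry.Motives.AbelianVarietyTheoremOfCubeProofs
import Literature.AlgebraicGeometry.Motives.CechComplexPseudoCoherentGeneralProofs
import HarnessLib

/-!
# `[n]^*D ∼ ((n²+n)/2) D + ((n²−n)/2) [-1]^*D` on an abelian variety (Görtz–Wedhorn II, Prop. 27.184 (1))

Discharge of the named fact `AbelianVariety.pullback_zsmul_id_linEquiv`
(`Motives/AbelianVarietyDegree`; Görtz–Wedhorn II, Prop. 27.184 (1) with Rem. 27.185) from the
Theorem of the Cube chain of this directory (`Motives/AbelianVarietyTheoremOfCubeProofs`: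
Thm. 24.73 ⟹ Prop. 27.167 ⟹ Prop. 27.184 (1)) and the finiteness of the coherent cohomology of
proper morphisms in Čech form (`cechComplex_pseudoCoherent_general_holds`,
`Motives/CechComplexPseudoCoherentGeneralProofs`; Görtz–Wedhorn II, Thm. 23.133 / Cor. 23.135). The
inputs of that chain proved by this unit: Step (I) of Lemma 24.72
(`theoremOfCube_trivialAlong_thickeningPt_holds`, `Motives/CubeStepI`), the flat descent of rational
functions (`Motives/RatFnFlatDescent`) and Lemma 24.67 (`Motives/CartierDivisorPullbackFromBase`).

* `AbelianVariety.pullback_zsmul_id_linEquiv_holds` — the discharge (the parameters `K`, `A` are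
  those of the `def`; the cubical structure `AbelianVariety.cubicalStructure_linEquiv` is left to its
  own unit, `AbelianVariety.cubicalStructure_linEquiv_of_pseudoCoherent_general` being available).

No named facts are introduced. Mathlib searched (pin): no abelian varieties, no theorem of the cube.

## References

* U. Görtz, T. Wedhorn, *Algebraic Geometry II: Cohomology of Schemes*, Springer Spektrum (2023),
  doi:10.1007/978-3-658-43031-3: Prop. 27.184 (1), Rem. 27.185 (p. 886); Prop. 27.167
  (pp. 877–878); Thm. 24.73 (p. 550). [GortzWedhorn2023]
-/

universe u

noncomputable section

namespace Literature.AlgebraicGeometry.Motives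

/-- **Görtz–Wedhorn II, Prop. 27.184 (1) with Rem. 27.185: for a symmetric divisor class `D` on an
abelian variety and `n ∈ ℤ` with `[n]_A` dominant, `[n]^*D ∼ ((n²+n)/2) D + ((n²−n)/2) [-1]^*D`** —
discharge of `AbelianVariety.pullback_zsmul_id_linEquiv`.
[cite: GortzWedhorn2023, Prop. 27.184 (1) and Rem. 27.185 (p. 886)] -/
theorem AbelianVariety.pullback_zsmul_id_linEquiv_holds {K : Type u} [Field K] (A : AbelianVariety K) :
    A.pullback_zsmul_id_linEquiv :=
  A.pullback_zsmul_id_linEquiv_of_pseudoCoherent_general cechComplex_pseudoCoherent_general_holds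

end Literature.AlgebraicGeometry.Motives

end
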